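import Summits.Ventures.LatticeQCDFlow.Scoring.SU2TorusPlaquetteCharacterIntegral
import Summits.Ventures.LatticeQCDFlow.Scoring.SU2TorusPartitionFunction
import Summits.Ventures.LatticeQCDFlow.Scoring.SU2PlaquetteSeriesFubiniWeighted
import Summits.Ventures.LatticeQCDFlow.Scaling.LatticeGibbs
import HarnessLib

/-!
# SU(2) on the 2-torus: THE EXACT FINITE-VOLUME PLAQUETTE `⟨½ tr U_p⟩_{(ℤ/L)², β}` as a Bessel-type series

HONEST FRAMING: exact (Metropolis-corrected) sampling algorithms for lattice gauge theory;
figures of merit are autocorrelation/cost numbers at stated couplings and volumes; no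
continuum-physics claim.

Venture `LatticeQCDFlow` (cell pub-lqcd), sub-topic `Scoring`; FANOUT row 5 (`s0-sun-a`), GEN-10.
NEW WORK of the cell (placement rule); the finite-volume SU(2) entry of the row's 'exact 2-d plaquette
oracle' column as a THEOREM about theory-2's Wilson measure `wilsonMeasure (fundamentalRep (Fin 2)) β`
on `(ℤ/L)²` (every `L ≥ 1`, `β ≥ 0`).  With `c_n(β) = e^{−2β}(I_n(2β) − I_{n+2}(2β))` (the Haar
character coefficients of the plaquette weight, `c_n/(n+1) = e^{−2β}I_{n+1}(2β)/β`):

* `integral_su2a0_mul_exp_neg_wilsonAction_eq_tsum` — the character expansion of the plaquette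
  insertion: `∫ a₀(U_{x₀}) e^{−βS} dHaar^{⊗E} = Σ'_{x : plaquettes → ℕ} (∏_p c_{x_p}) ∫ a₀(U_{x₀}) ∏_p χ_{x_p}(U_p)`;
* **`integral_su2a0_mul_exp_neg_wilsonAction_two`** — its evaluation: only the assignments
  `x ≡ n+1` off `x₀`, `x_{x₀} = n` and `x ≡ n` off `x₀`, `x_{x₀} = n+1` survive, whence
  `∫ a₀(U_{x₀}) e^{−βS} dHaar^{⊗E} = ½ Σ_n [c_n c_{n+1}^{L²−1}/(n+2)^{L²} + c_{n+1} c_n^{L²−1}/(n+1)^{L²}]`;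
* **`wilson_mean_su2a0_plaquette_two`** — THE EXACT TORUS PLAQUETTE:
  `⟨½ tr U_{x₀}⟩_{(ℤ/L)²,β} = ½ Σ_n [c_n c_{n+1}^{L²−1}/(n+2)^{L²} + c_{n+1} c_n^{L²−1}/(n+1)^{L²}] / Σ_n (c_n/(n+1))^{L²}`
  (as `L → ∞` the `n = 0` terms dominate and the ratio tends to `c_1/(2c_0) = I₂(2β)/I₁(2β)`, the
  infinite-volume value of the cell's reference table).

Nothing is cited as a fact; no `def`.
-/

noncomputable section

open Real MeasureTheory Set Function Finset Polynomial.Chebyshev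
open Literature.MathematicalPhysics.QuantumFieldTheory Literature.MathematicalPhysics.QuantumLattice
open Literature.Analysis.FunctionSpaces
open Summit.Ventures.LatticeQCDFlow.Exactness
open Summit.Ventures.LatticeQCDFlow.Theory2.Lattice

namespace Summit.Ventures.LatticeQCDFlow.Scoring

variable {L : ℕ} [NeZero L]

/-! ## §1. The character expansion of the plaquette insertion -/

/-- **The plaquette insertion, expanded in characters**: for `β ≥ 0` and a plaquette `x₀` of
`(ℤ/L)²`, `∫ a₀(U_{x₀}) e^{−βS(U)} dHaar^{⊗E} = Σ'_{x : plaquettes → ℕ} (∏_p c_{x_p}(β)) ·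
∫ a₀(U_{x₀}) ∏_p χ_{x_p}(U_p) dHaar^{⊗E}`, the series converging absolutely. -/
theorem integral_su2a0_mul_exp_neg_wilsonAction_eq_tsum {β : ℝ} (hβ : 0 ≤ β) (x₀ : Site 2 L) :
    (Summable fun x : Plaquette 2 L → ℕ => (∏ p, Real.exp (-(2 * β)) *
        (besselI (x p) (2 * β) - besselI (x p + 2) (2 * β))) *
        ∫ V, su2a0 (plaquetteHolonomy V x₀ 0 1) *
          ∏ p : Plaquette 2 L, (U ℝ (x p)).eval (su2a0 (plaquetteHolonomy V p.1 p.2.1.1 p.2.1.2))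
          ∂(Measure.pi fun _ : Edge 2 L => haarProbability (Matrix.specialUnitaryGroup (Fin 2) ℂ))) ∧
    ∫ V, su2a0 (plaquetteHolonomy V x₀ 0 1) * Real.exp (-β * wilsonAction (fundamentalRep (Fin 2)) V)
        ∂(Measure.pi fun _ : Edge 2 L => haarProbability (Matrix.specialUnitaryGroup (Fin 2) ℂ)) =
      ∑' x : Plaquette 2 L → ℕ, (∏ p, Real.exp (-(2 * β)) *
        (besselI (x p) (2 * β) - besselI (x p + 2) (2 * β))) *
        ∫ V, su2a0 (plaquetteHolonomy V x₀ 0 1) *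
          ∏ p : Plaquette 2 L, (U ℝ (x p)).eval (su2a0 (plaquetteHolonomy V p.1 p.2.1.1 p.2.1.2))
          ∂(Measure.pi fun _ : Edge 2 L => haarProbability (Matrix.specialUnitaryGroup (Fin 2) ℂ)) := by
  haveI := secondCountableTopology_su2
  have ham : ∀ p : Plaquette 2 L, Measurable fun V : GaugeConfig 2 L (Matrix.specialUnitaryGroup (Fin 2) ℂ) =>
      su2a0 (plaquetteHolonomy V p.1 p.2.1.1 p.2.1.2) :=
    fun p => continuous_su2a0.measurable.comp
      (Literature.MathematicalPhysics.QuantumFieldTheory.measurable_plaquetteHolonomy p.1 p.2.1.1 p.2.1.2)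
  have ha : ∀ (p : Plaquette 2 L) (V : GaugeConfig 2 L (Matrix.specialUnitaryGroup (Fin 2) ℂ)),
      su2a0 (plaquetteHolonomy V p.1 p.2.1.1 p.2.1.2) ∈ Icc (-1 : ℝ) 1 :=
    fun p V => abs_le.mp (abs_su2a0_le_one _)
  have hgm : Measurable fun V : GaugeConfig 2 L (Matrix.specialUnitaryGroup (Fin 2) ℂ) =>
      su2a0 (plaquetteHolonomy V x₀ 0 1) :=
    continuous_su2a0.measurable.comp (TwoDim.measurable_plaquetteHolonomy x₀)
  have h := integral_mul_prod_plaqWeight_eq_tsum_fintype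
    (Measure.pi fun _ : Edge 2 L => haarProbability (Matrix.specialUnitaryGroup (Fin 2) ℂ)) hβ
    (fun (p : Plaquette 2 L) (V : GaugeConfig 2 L (Matrix.specialUnitaryGroup (Fin 2) ℂ)) =>
      su2a0 (plaquetteHolonomy V p.1 p.2.1.1 p.2.1.2)) ham ha
    (fun V => su2a0 (plaquetteHolonomy V x₀ 0 1)) hgm (fun V => abs_su2a0_le_one _)
  refine ⟨h.1, ?_⟩
  rw [← h.2]
  refine integral_congr_ae (Filter.Eventually.of_forall fun V => ?_)
  beta_reduce
  rw [exp_neg_mul_wilsonAction_su2 β V]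

/-! ## §2. The surviving assignments -/

/-- The product of character coefficients of an assignment constant off one plaquette:
`∏_p c(update (const n) p₀ v) = c_v · c_n^{L²−1}`. -/
theorem prod_update_const (c : ℕ → ℝ) (p₀ : Plaquette 2 L) (n v : ℕ) :
    ∏ p : Plaquette 2 L, c (update (fun _ : Plaquette 2 L => n) p₀ v p) = c v * c n ^ (L ^ 2 - 1) := by
  rw [← Finset.mul_prod_erase _ _ (Finset.mem_univ p₀), update_self]
  congr 1
  rw [Finset.prod_congr rfl (fun p hp => by rw [update_of_ne (Finset.ne_of_mem_erase hp)]),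
    Finset.prod_const, Finset.card_erase_of_mem (Finset.mem_univ _), Finset.card_univ]
  congr 1
  let e : Plaquette 2 L ≃ Site 2 L :=
    { toFun := fun p => p.1
      invFun := fun x => (x, ⟨((0 : Fin 2), (1 : Fin 2)), by decide⟩)
      left_inv := fun p => (plaquette_two_eq p).symm
      right_inv := fun _ => rfl }
  rw [Fintype.card_congr e, Flux.card_site_two]

/-- **The expansion term of the plaquette insertion**: for `x : plaquettes → ℕ` with base-site
assignment `m`, `(∏_p c_{x_p}) ∫ a₀(U_{x₀}) ∏_p χ_{x_p}(U_p) = (∏_p c_{x_p})·(½ I(m⁺) + ½[m_{x₀} ≠ 0] I(m⁻))`. -/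
theorem insertion_term_two (β : ℝ) (x₀ : Site 2 L) (x : Plaquette 2 L → ℕ) :
    (∏ p, Real.exp (-(2 * β)) * (besselI (x p) (2 * β) - besselI (x p + 2) (2 * β))) *
        ∫ V, su2a0 (plaquetteHolonomy V x₀ 0 1) *
          ∏ p : Plaquette 2 L, (U ℝ (x p)).eval (su2a0 (plaquetteHolonomy V p.1 p.2.1.1 p.2.1.2))
          ∂(Measure.pi fun _ : Edge 2 L => haarProbability (Matrix.specialUnitaryGroup (Fin 2) ℂ)) =
      (∏ p, Real.exp (-(2 * β)) * (besselI (x p) (2 * β) - besselI (x p + 2) (2 * β))) *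
        ((1 / 2) * (if (∀ s : Site 2 L,
              update (fun s : Site 2 L => x (s, ⟨((0 : Fin 2), (1 : Fin 2)), by decide⟩)) x₀
                  (x (x₀, ⟨((0 : Fin 2), (1 : Fin 2)), by decide⟩) + 1) s =
                update (fun s : Site 2 L => x (s, ⟨((0 : Fin 2), (1 : Fin 2)), by decide⟩)) x₀
                  (x (x₀, ⟨((0 : Fin 2), (1 : Fin 2)), by decide⟩) + 1) 0) then
            ((((update (fun s : Site 2 L => x (s, ⟨((0 : Fin 2), (1 : Fin 2)), by decide⟩)) x₀
                (x (x₀, ⟨((0 : Fin 2), (1 : Fin 2)), by decide⟩) + 1) 0 : ℕ) : ℝ) + 1) ^ (L ^ 2))⁻¹ else 0) +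
          (1 / 2) * (if x (x₀, ⟨((0 : Fin 2), (1 : Fin 2)), by decide⟩) = 0 then 0 else
            if (∀ s : Site 2 L,
                update (fun s : Site 2 L => x (s, ⟨((0 : Fin 2), (1 : Fin 2)), by decide⟩)) x₀
                    (x (x₀, ⟨((0 : Fin 2), (1 : Fin 2)), by decide⟩) - 1) s =
                  update (fun s : Site 2 L => x (s, ⟨((0 : Fin 2), (1 : Fin 2)), by decide⟩)) x₀
                    (x (x₀, ⟨((0 : Fin 2), (1 : Fin 2)), by decide⟩) - 1) 0) then
              ((((update (fun s : Site 2 L => x (s, ⟨((0 : Fin 2), (1 : Fin 2)), by decide⟩)) x₀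
                  (x (x₀, ⟨((0 : Fin 2), (1 : Fin 2)), by decide⟩) - 1) 0 : ℕ) : ℝ) + 1) ^ (L ^ 2))⁻¹ else 0)) := by
  congr 1
  have hint : (fun V : GaugeConfig 2 L (Matrix.specialUnitaryGroup (Fin 2) ℂ) =>
      su2a0 (plaquetteHolonomy V x₀ 0 1) *
        ∏ p : Plaquette 2 L, (U ℝ (x p)).eval (su2a0 (plaquetteHolonomy V p.1 p.2.1.1 p.2.1.2))) =
      fun V => su2a0 (plaquetteHolonomy V x₀ 0 1) *
        ∏ s : Site 2 L, (U ℝ ((fun s : Site 2 L => x (s, ⟨((0 : Fin 2), (1 : Fin 2)), by decide⟩)) s)).eval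
          (su2a0 (plaquetteHolonomy V s 0 1)) := by
    funext V
    rw [prod_plaquette_two]
  rw [hint, integral_su2a0_mul_prod_su2Character_plaquettes]

/-! ## §3. The plaquette insertion as a series over `ℕ` -/

/-- **`∫ a₀(U_{x₀}) e^{−βS} dHaar^{⊗E} = ½ Σ_n [c_n c_{n+1}^{L²−1}/(n+2)^{L²} + c_{n+1} c_n^{L²−1}/(n+1)^{L²}]`**
(`β ≥ 0`, `L ≥ 1`, `c_n = e^{−2β}(I_n(2β) − I_{n+2}(2β))`), as a `HasSum`. -/
theorem hasSum_integral_su2a0_mul_exp_neg_wilsonAction_two {β : ℝ} (hβ : 0 ≤ β) (x₀ : Site 2 L) :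
    HasSum (fun n : ℕ => (1 / 2) *
        ((Real.exp (-(2 * β)) * (besselI n (2 * β) - besselI (n + 2) (2 * β))) *
            (Real.exp (-(2 * β)) * (besselI (n + 1) (2 * β) - besselI (n + 1 + 2) (2 * β))) ^ (L ^ 2 - 1) *
            ((((n : ℝ) + 1 + 1) ^ (L ^ 2)))⁻¹ +
          (Real.exp (-(2 * β)) * (besselI (n + 1) (2 * β) - besselI (n + 1 + 2) (2 * β))) *
            (Real.exp (-(2 * β)) * (besselI n (2 * β) - besselI (n + 2) (2 * β))) ^ (L ^ 2 - 1) *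
            ((((n : ℝ) + 1) ^ (L ^ 2)))⁻¹))
      (∫ V, su2a0 (plaquetteHolonomy V x₀ 0 1) * Real.exp (-β * wilsonAction (fundamentalRep (Fin 2)) V)
        ∂(Measure.pi fun _ : Edge 2 L => haarProbability (Matrix.specialUnitaryGroup (Fin 2) ℂ))) := by
  obtain ⟨hsum, hN⟩ := integral_su2a0_mul_exp_neg_wilsonAction_eq_tsum (L := L) hβ x₀
  -- abbreviations: the plane, the observed plaquette, the coefficients, the base-site assignment
  set pl : {p : Fin 2 × Fin 2 // p.1 < p.2} := ⟨((0 : Fin 2), (1 : Fin 2)), by decide⟩ with hpl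
  set p₀ : Plaquette 2 L := (x₀, pl) with hp₀
  set c : ℕ → ℝ := fun n => Real.exp (-(2 * β)) * (besselI n (2 * β) - besselI (n + 2) (2 * β)) with hc
  have hc0 : ∀ n, 0 ≤ c n := fun n => charCoeff_nonneg hβ n
  -- the two surviving families of terms
  set Tp : (Plaquette 2 L → ℕ) → ℝ := fun x => (∏ p, c (x p)) * ((1 / 2) *
    (if (∀ s : Site 2 L, update (fun s : Site 2 L => x (s, pl)) x₀ (x p₀ + 1) s =
        update (fun s : Site 2 L => x (s, pl)) x₀ (x p₀ + 1) 0) then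
      ((((update (fun s : Site 2 L => x (s, pl)) x₀ (x p₀ + 1) 0 : ℝ) + 1) ^ (L ^ 2)))⁻¹ else 0)) with hTp
  set Tm : (Plaquette 2 L → ℕ) → ℝ := fun x => (∏ p, c (x p)) * ((1 / 2) *
    (if x p₀ = 0 then 0 else
      if (∀ s : Site 2 L, update (fun s : Site 2 L => x (s, pl)) x₀ (x p₀ - 1) s =
          update (fun s : Site 2 L => x (s, pl)) x₀ (x p₀ - 1) 0) then
        ((((update (fun s : Site 2 L => x (s, pl)) x₀ (x p₀ - 1) 0 : ℝ) + 1) ^ (L ^ 2)))⁻¹ else 0)) with hTm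
  have hT : ∀ x : Plaquette 2 L → ℕ,
      (∏ p, Real.exp (-(2 * β)) * (besselI (x p) (2 * β) - besselI (x p + 2) (2 * β))) *
      ∫ V, su2a0 (plaquetteHolonomy V x₀ 0 1) *
        ∏ p : Plaquette 2 L, (U ℝ (x p)).eval (su2a0 (plaquetteHolonomy V p.1 p.2.1.1 p.2.1.2))
        ∂(Measure.pi fun _ : Edge 2 L => haarProbability (Matrix.specialUnitaryGroup (Fin 2) ℂ)) =
      Tp x + Tm x := by
    intro x
    rw [insertion_term_two β x₀ x, hTp, hTm, hc]
    simp only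
    ring
  simp_rw [hT] at hsum hN
  have hprod0 : ∀ x : Plaquette 2 L → ℕ, 0 ≤ ∏ p, c (x p) := fun x => Finset.prod_nonneg fun p _ => hc0 _
  have hTp0 : ∀ x, 0 ≤ Tp x := by
    intro x
    rw [hTp]
    refine mul_nonneg (hprod0 x) (mul_nonneg (by norm_num) ?_)
    split_ifs <;> positivity
  have hTm0 : ∀ x, 0 ≤ Tm x := by
    intro x
    rw [hTm]
    refine mul_nonneg (hprod0 x) (mul_nonneg (by norm_num) ?_)
    split_ifs <;> positivity
  have hTps : Summable Tp :=
    Summable.of_nonneg_of_le hTp0 (fun x => le_add_of_nonneg_right (hTm0 x)) hsum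
  have hTms : Summable Tm :=
    Summable.of_nonneg_of_le hTm0 (fun x => le_add_of_nonneg_left (hTp0 x)) hsum
  -- the surviving assignments
  set g₁ : ℕ → (Plaquette 2 L → ℕ) := fun n => update (fun _ => n + 1) p₀ n with hg₁
  set g₂ : ℕ → (Plaquette 2 L → ℕ) := fun n => update (fun _ => n) p₀ (n + 1) with hg₂
  have hg₁inj : Injective g₁ := fun n n' h => by
    have := congrFun h p₀
    simpa [hg₁] using this
  have hg₂inj : Injective g₂ := fun n n' h => by
    have := congrFun h p₀
    simpa [hg₂] using this
  -- a plaquette other than `p₀` has base site `≠ x₀`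
  have hbase : ∀ p : Plaquette 2 L, p ≠ p₀ → p.1 ≠ x₀ := by
    intro p hp h1
    exact hp (by rw [plaquette_two_eq p, h1])
  have hsuppTp : support Tp ⊆ Set.range g₁ := by
    intro x hx
    rw [mem_support, hTp] at hx
    simp only at hx
    have hcst : ∀ s : Site 2 L, update (fun s : Site 2 L => x (s, pl)) x₀ (x p₀ + 1) s =
        update (fun s : Site 2 L => x (s, pl)) x₀ (x p₀ + 1) 0 := by
      by_contra h
      rw [if_neg h, mul_zero, mul_zero] at hx
      exact hx rfl
    refine ⟨x p₀, funext fun p => ?_⟩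
    by_cases hp : p = p₀
    · rw [hp, hg₁]
      simp
    · rw [hg₁]
      simp only [update_of_ne hp]
      have h1 := hcst p.1
      rw [update_of_ne (hbase p hp), ← hcst x₀, update_self] at h1
      rw [plaquette_two_eq p]
      exact h1.symm
  have hsuppTm : support Tm ⊆ Set.range g₂ := by
    intro x hx
    rw [mem_support, hTm] at hx
    simp only at hx
    have h0 : x p₀ ≠ 0 := by
      intro h
      rw [if_pos h, mul_zero, mul_zero] at hx
      exact hx rfl
    rw [if_neg h0] at hx
    have hcst : ∀ s : Site 2 L, update (fun s : Site 2 L => x (s, pl)) x₀ (x p₀ - 1) s =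
        update (fun s : Site 2 L => x (s, pl)) x₀ (x p₀ - 1) 0 := by
      by_contra h
      rw [if_neg h, mul_zero, mul_zero] at hx
      exact hx rfl
    refine ⟨x p₀ - 1, funext fun p => ?_⟩
    by_cases hp : p = p₀
    · rw [hp, hg₂]
      simp only [update_self]
      omega
    · rw [hg₂]
      simp only [update_of_ne hp]
      have h1 := hcst p.1
      rw [update_of_ne (hbase p hp), ← hcst x₀, update_self] at h1
      rw [plaquette_two_eq p]
      exact h1.symm
  -- the values on the surviving assignments
  have hup₁ : ∀ n : ℕ, update (fun s : Site 2 L => g₁ n (s, pl)) x₀ (g₁ n p₀ + 1) =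
      fun _ => n + 1 := by
    intro n
    funext s
    by_cases hs : s = x₀
    · rw [hs, update_self, hg₁]
      simp
    · rw [update_of_ne hs, hg₁]
      have : ((s, pl) : Plaquette 2 L) ≠ p₀ := fun h => hs (congrArg Prod.fst h)
      simp [update_of_ne this]
  have hup₂ : ∀ n : ℕ, update (fun s : Site 2 L => g₂ n (s, pl)) x₀ (g₂ n p₀ - 1) =
      fun _ => n := by
    intro n
    funext s
    by_cases hs : s = x₀
    · rw [hs, update_self, hg₂]
      simp
    · rw [update_of_ne hs, hg₂]
      have : ((s, pl) : Plaquette 2 L) ≠ p₀ := fun h => hs (congrArg Prod.fst h)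
      simp [update_of_ne this]
  have hTpg : ∀ n : ℕ, Tp (g₁ n) = (1 / 2) * (c n * c (n + 1) ^ (L ^ 2 - 1) *
      ((((n : ℝ) + 1 + 1) ^ (L ^ 2)))⁻¹) := by
    intro n
    rw [hTp]
    simp only
    rw [hup₁ n, if_pos (fun _ => rfl), hg₁, prod_update_const]
    push_cast
    ring
  have hTmg : ∀ n : ℕ, Tm (g₂ n) = (1 / 2) * (c (n + 1) * c n ^ (L ^ 2 - 1) *
      ((((n : ℝ) + 1) ^ (L ^ 2)))⁻¹) := by
    intro n
    rw [hTm]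
    simp only
    have hne : g₂ n p₀ ≠ 0 := by rw [hg₂]; simp
    rw [if_neg hne, hup₂ n, if_pos (fun _ => rfl), hg₂, prod_update_const]
    ring
  -- assemble
  have h1 : HasSum (Tp ∘ g₁) (∑' x, Tp x) := by
    rw [← hg₁inj.tsum_eq hsuppTp]
    exact (hTps.comp_injective hg₁inj).hasSum
  have h2 : HasSum (Tm ∘ g₂) (∑' x, Tm x) := by
    rw [← hg₂inj.tsum_eq hsuppTm]
    exact (hTms.comp_injective hg₂inj).hasSum
  have h12 := h1.add h2
  rw [← hTps.tsum_add hTms, ← hN] at h12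
  refine h12.congr_fun fun n => ?_
  simp only [Function.comp_apply, hTpg, hTmg, hc]
  ring

/-- **`∫ a₀(U_{x₀}) e^{−βS} dHaar^{⊗E}`** as the series (`β ≥ 0`, `L ≥ 1`). -/
theorem integral_su2a0_mul_exp_neg_wilsonAction_two {β : ℝ} (hβ : 0 ≤ β) (x₀ : Site 2 L) :
    ∫ V, su2a0 (plaquetteHolonomy V x₀ 0 1) * Real.exp (-β * wilsonAction (fundamentalRep (Fin 2)) V)
        ∂(Measure.pi fun _ : Edge 2 L => haarProbability (Matrix.specialUnitaryGroup (Fin 2) ℂ)) =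
      ∑' n : ℕ, (1 / 2) *
        ((Real.exp (-(2 * β)) * (besselI n (2 * β) - besselI (n + 2) (2 * β))) *
            (Real.exp (-(2 * β)) * (besselI (n + 1) (2 * β) - besselI (n + 1 + 2) (2 * β))) ^ (L ^ 2 - 1) *
            ((((n : ℝ) + 1 + 1) ^ (L ^ 2)))⁻¹ +
          (Real.exp (-(2 * β)) * (besselI (n + 1) (2 * β) - besselI (n + 1 + 2) (2 * β))) *
            (Real.exp (-(2 * β)) * (besselI n (2 * β) - besselI (n + 2) (2 * β))) ^ (L ^ 2 - 1) *
            ((((n : ℝ) + 1) ^ (L ^ 2)))⁻¹) :=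
  (hasSum_integral_su2a0_mul_exp_neg_wilsonAction_two hβ x₀).tsum_eq.symm

/-! ## §4. The exact torus plaquette -/

/-- Expectations under theory-2's SU(2) Wilson measure are weighted Haar integrals divided by `Z`. -/
theorem integral_wilsonMeasure_su2_eq_div (β : ℝ) (f : GaugeConfig 2 L (Matrix.specialUnitaryGroup (Fin 2) ℂ) → ℝ) :
    ∫ V, f V ∂(wilsonMeasure (d := 2) (L := L) (fundamentalRep (Fin 2)) β) =
      (∫ V, f V * Real.exp (-β * wilsonAction (fundamentalRep (Fin 2)) V)
        ∂(Measure.pi fun _ : Edge 2 L => haarProbability (Matrix.specialUnitaryGroup (Fin 2) ℂ))) /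
      (partitionFunction (d := 2) (L := L) (fundamentalRep (Fin 2)) β).toReal := by
  haveI := secondCountableTopology_su2
  have hf := measurable_wilsonDensity (d := 2) (L := L) (fundamentalRep (Fin 2)) (continuous_fundamentalRep _) β
  show ∫ V, f V ∂((partitionFunction (fundamentalRep (Fin 2)) β)⁻¹ •
    wilsonWeight (d := 2) (L := L) (fundamentalRep (Fin 2)) β) = _
  rw [integral_smul_measure, smul_eq_mul, ENNReal.toReal_inv, inv_mul_eq_div]
  congr 1
  show ∫ V, f V ∂((Measure.pi fun _ : Edge 2 L => haarProbability (Matrix.specialUnitaryGroup (Fin 2) ℂ)).withDensity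
    fun V => ENNReal.ofReal (Real.exp (-β * wilsonAction (fundamentalRep (Fin 2)) V))) = _
  rw [integral_withDensity_eq_integral_toReal_smul hf (ae_of_all _ fun _ => ENNReal.ofReal_lt_top)]
  refine integral_congr_ae (ae_of_all _ fun V => ?_)
  simp only [smul_eq_mul]
  rw [ENNReal.toReal_ofReal (Real.exp_nonneg _), mul_comm]

/-- **THE EXACT SU(2) PLAQUETTE ON THE 2-TORUS.**  For every `L ≥ 1`, `β ≥ 0` and plaquette `x₀` of
`(ℤ/L)²`, under theory-2's Wilson measure `wilsonMeasure (fundamentalRep (Fin 2)) β`: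
`⟨½ tr U_{x₀}⟩ = ½ Σ_n [c_n c_{n+1}^{L²−1}/(n+2)^{L²} + c_{n+1} c_n^{L²−1}/(n+1)^{L²}] / Σ_n (c_n/(n+1))^{L²}`,
`c_n = e^{−2β}(I_n(2β) − I_{n+2}(2β))` — the finite-volume SU(2) entry of the exact 2-d plaquette
oracle, now a theorem about the Haar-based lattice measure. -/
theorem wilson_mean_su2a0_plaquette_two {β : ℝ} (hβ : 0 ≤ β) (x₀ : Site 2 L) :
    ∫ V, su2a0 (plaquetteHolonomy V x₀ 0 1) ∂(wilsonMeasure (d := 2) (L := L) (fundamentalRep (Fin 2)) β) =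
      (∑' n : ℕ, (1 / 2) *
        ((Real.exp (-(2 * β)) * (besselI n (2 * β) - besselI (n + 2) (2 * β))) *
            (Real.exp (-(2 * β)) * (besselI (n + 1) (2 * β) - besselI (n + 1 + 2) (2 * β))) ^ (L ^ 2 - 1) *
            ((((n : ℝ) + 1 + 1) ^ (L ^ 2)))⁻¹ +
          (Real.exp (-(2 * β)) * (besselI (n + 1) (2 * β) - besselI (n + 1 + 2) (2 * β))) *
            (Real.exp (-(2 * β)) * (besselI n (2 * β) - besselI (n + 2) (2 * β))) ^ (L ^ 2 - 1) *
            ((((n : ℝ) + 1) ^ (L ^ 2)))⁻¹)) /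
      ∑' n : ℕ, (Real.exp (-(2 * β)) * (besselI n (2 * β) - besselI (n + 2) (2 * β)) /
        ((n : ℝ) + 1)) ^ (L ^ 2) := by
  rw [integral_wilsonMeasure_su2_eq_div, integral_su2a0_mul_exp_neg_wilsonAction_two hβ,
    partitionFunction_su2_two_toReal_eq_tsum hβ]

end Summit.Ventures.LatticeQCDFlow.Scoring
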